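import Mathlib.AlgebraicGeometry.Morphisms.Smooth
import Mathlib.AlgebraicGeometry.Morphisms.FinitePresentation
import Mathlib.AlgebraicGeometry.Properties
import Mathlib.RingTheory.Localization.InvSubmonoid
import Mathlib.RingTheory.LocalProperties.Reduced
import Literature.AlgebraicGeometry.RealAlgebraic.RestrictedPolynomialRing
import Literature.NumberTheory.Transcendental.AnalytificationChartsProofs
import Literature.NumberTheory.Transcendental.AnalytificationProjProofs
import Literature.AlgebraicGeometry.Motives.AbelianVarietyProofs
import Literature.AlgebraicGeometry.Resolution.PrincipalizationToResolution
import Literature.AlgebraicGeometry.Resolution.MaximalContact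
import HarnessLib

/-!
# A smooth real algebraic model of a homogeneous real-Zariski-closed set

Let `C ⊆ 𝔼` be a subset of a finite-dimensional real normed space which is **real Zariski
closed** (every point off `C` is separated from `C` by a polynomial function vanishing on `C`)
and **homogeneous** (a set of affine automorphisms of `𝔼` preserving `C` acts transitively on
`C`) — e.g. a compact linear group `H ⊆ M_n` (Chevalley: `H` is the real zero set of the
polynomials vanishing on it) or `H × V` for a vector space `V`. Let `ℝ[C]` be its ring of
polynomial functions (`RealAlgebraic/RestrictedPolynomialRing`). This file proves that the affine
`ℝ`-scheme `Spec ℝ[C]` is **smooth over `ℝ` at every point of `C`** and extracts, around any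
`c₀ ∈ C`, a basic open `D(t) ∋ c₀` of `Spec ℝ[C]` which is smooth over `ℝ` and irreducible
(`exists_smooth_irreducible_basicOpen`):

1. `ℝ[C]` is a reduced `ℝ`-algebra of finite type, so the smooth locus of
   `Spec ℝ[C] → Spec ℝ` is a dense open (generic smoothness over a perfect field, Mathlib
   `Scheme.Hom.dense_smoothLocus_of_perfectField`);
2. the points `𝔭_c = ker ev_c`, `c ∈ C`, are Zariski dense (`ℝ[C]` is a ring of functions on
   `C`), so some `𝔭_c` is a smooth point;
3. the affine automorphisms act on `Spec ℝ[C]` over `ℝ`, preserve the smooth locus and permute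
   the `𝔭_c` transitively, so EVERY `𝔭_c` is a smooth point (homogeneity; Onishchik–Vinberg
   Ch. 3 §3.3: a real algebraic group is a smooth variety);
4. at a smooth point the local ring is regular, hence a domain, so `𝔭_{c₀}` lies on a single
   irreducible component (the tree's `eq_of_mem_irreducibleComponents_of_isDomain_stalk`), and a
   basic open neighbourhood inside the smooth locus and off the other components is irreducible.

Finally `exists_smooth_algebraic_model` packages, for the consumer
(`MathematicalPhysics/QuantumFieldTheory/WilsonPartitionRegularVariationHolds`), the smooth
integral separated finite-type affine `ℝ`-scheme `W = Spec ℝ[C]_t` together with the coordinate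
embedding `ι : W(ℝ) → 𝔼` (continuous, inducing, injective, `ι(W(ℝ)) = C ∩ {t ≠ 0}`), the fact that
polynomial functions on `𝔼` are global regular functions on `W` through `ι`, and the fact that
regular functions on opens of `W` are, near each real point, restrictions through `ι` of
real-analytic functions (quotients of polynomials) on open subsets of `𝔼`.

Everything is proved; no named facts (the only new definitions are `pointOf` — the point `𝔭_c` of
`Spec ℝ[C]` — and the abbreviation `structureMap`, besides those of `RestrictedPolynomialRing`).

## References

* A. L. Onishchik, E. B. Vinberg, *Lie Groups and Algebraic Groups* (1990), Ch. 3 §§3.1–3.3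
  (real algebraic groups are smooth; polynomial functions). [OnishchikVinberg1990]
* C. Chevalley, *Theory of Lie Groups I* (1946), Ch. VI §§VIII–IX. [Chevalley1946]
* J. Bochnak, M. Coste, M.-F. Roy, *Real Algebraic Geometry* (1998), §3.2, Prop. 3.3.11.
  [BochnakCosteRoy1998]
-/

noncomputable section

open Set MvPolynomial Function CategoryTheory AlgebraicGeometry TopologicalSpace

namespace Literature.AlgebraicGeometry.RealAlgebraic

open Literature.RepresentationTheory.CompactGroups Literature.AlgebraicGeometry.Resolution

universe u

variable {𝔼 : Type} [NormedAddCommGroup 𝔼] [NormedSpace ℝ 𝔼] [FiniteDimensional ℝ 𝔼]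
  {C : Set 𝔼}

/-! ### The points `𝔭_c` of `Spec ℝ[C]` -/

/-- The prime `𝔭_c = ker ev_c` of `ℝ[C]` at a point `c ∈ C`, as a point of `Spec ℝ[C]`.
[cite: BochnakCosteRoy1998, §3.2] -/
def pointOf {c : 𝔼} (hc : c ∈ C) : PrimeSpectrum (PolyRing C) :=
  ⟨RingHom.ker (evalAt hc : PolyRing C →+* ℝ), RingHom.ker_isPrime _⟩

omit [FiniteDimensional ℝ 𝔼] in
/-- `𝔭_c ∈ D(r)` iff `r(c) ≠ 0`. [folklore] -/
theorem pointOf_mem_basicOpen_iff {c : 𝔼} (hc : c ∈ C) (r : PolyRing C) :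
    pointOf hc ∈ PrimeSpectrum.basicOpen r ↔ evalAt hc r ≠ 0 := by
  rw [PrimeSpectrum.mem_basicOpen]
  exact Iff.rfl

omit [FiniteDimensional ℝ 𝔼] in
/-- **The points `𝔭_c`, `c ∈ C`, are Zariski dense in `Spec ℝ[C]`**: every non-empty open subset
contains one of them (a non-empty open contains a non-empty `D(r)`; `r` is not nilpotent, hence,
`ℝ[C]` being a ring of functions on `C`, `r(c) ≠ 0` for some `c`). [cite: BochnakCosteRoy1998, §3.2] -/
theorem exists_pointOf_mem_of_isOpen {O : Set (PrimeSpectrum (PolyRing C))} (hO : IsOpen O)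
    (hne : O.Nonempty) : ∃ (c : 𝔼) (hc : c ∈ C), pointOf hc ∈ O := by
  obtain ⟨x, hx⟩ := hne
  obtain ⟨_, ⟨r, rfl⟩, hxr, hrO⟩ :=
    PrimeSpectrum.isTopologicalBasis_basic_opens.exists_subset_of_mem_open hx hO
  have hxr' : x ∈ PrimeSpectrum.basicOpen r := hxr
  have hr : r ≠ 0 := by
    rintro rfl
    rw [PrimeSpectrum.basicOpen_zero] at hxr'
    simp at hxr'
  obtain ⟨c, hc, hcr⟩ : ∃ (c : 𝔼) (hc : c ∈ C), evalAt hc r ≠ 0 := by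
    by_contra h
    push Not at h
    exact hr ((eq_zero_iff_forall_evalAt r).2 h)
  exact ⟨c, hc, hrO (show pointOf hc ∈ (PrimeSpectrum.basicOpen r : Set _) from
    (pointOf_mem_basicOpen_iff hc r).2 hcr)⟩

omit [FiniteDimensional ℝ 𝔼] in
/-- The automorphism of `Spec ℝ[C]` induced by an affine automorphism of `𝔼` preserving `C` maps
`𝔭_c` to `𝔭_{A c + v}`. [folklore] -/
theorem comap_pullbackEquiv_pointOf (A : 𝔼 ≃L[ℝ] 𝔼) (v : 𝔼) (hAv : ∀ x ∈ C, A x + v ∈ C)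
    (hAv' : ∀ x ∈ C, A.symm x + (-A.symm v) ∈ C) {c : 𝔼} (hc : c ∈ C) :
    PrimeSpectrum.comap (pullbackEquiv A v hAv hAv' : PolyRing C →+* PolyRing C) (pointOf hc) =
      pointOf (hAv c hc) := by
  ext1
  exact comap_pullbackEquiv_ker_evalAt A v hAv hAv' hc

/-! ### The structure morphism and its smooth locus -/

variable (C)

/-- The structure morphism `Spec ℝ[C] → Spec ℝ`. [folklore] -/
abbrev structureMap : Spec (CommRingCat.of (PolyRing C)) ⟶ Spec (CommRingCat.of ℝ) :=
  Spec.map (CommRingCat.ofHom (algebraMap ℝ (PolyRing C)))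

/-- `Spec ℝ[C] → Spec ℝ` is locally of finite presentation (`ℝ[C]` is of finite type over the
Noetherian ring `ℝ`). [folklore] -/
instance locallyOfFinitePresentation_structureMap :
    LocallyOfFinitePresentation (structureMap C) := by
  rw [HasRingHomProperty.Spec_iff (P := @LocallyOfFinitePresentation)]
  change (algebraMap ℝ (PolyRing C)).FinitePresentation
  rw [← RingHom.FinitePresentation.of_finiteType, RingHom.finiteType_algebraMap]
  infer_instance

/-- `Spec ℝ[C] → Spec ℝ` is locally of finite type. [folklore] -/
instance locallyOfFiniteType_structureMap : LocallyOfFiniteType (structureMap C) := by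
  rw [HasRingHomProperty.Spec_iff (P := @LocallyOfFiniteType)]
  change (algebraMap ℝ (PolyRing C)).FiniteType
  rw [RingHom.finiteType_algebraMap]
  infer_instance

/-- `Spec ℝ[C]` is reduced (`ℝ[C]` is a ring of real-valued functions). [folklore] -/
instance isReduced_spec_polyRing : IsReduced (Spec (CommRingCat.of (PolyRing C))) :=
  (affine_isReduced_iff (CommRingCat.of (PolyRing C))).2 (isReduced_polyRing C)

/-- `ℝ[C]` is Noetherian (finite type over a field). [folklore] -/
instance isNoetherianRing_polyRing : IsNoetherianRing (PolyRing C) :=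
  Algebra.FiniteType.isNoetherianRing ℝ (PolyRing C)

variable {C}

/-- **Every point `𝔭_c`, `c ∈ C`, is a smooth point of `Spec ℝ[C] → Spec ℝ`** when `C` is
homogeneous under affine automorphisms of `𝔼` preserving it: the smooth locus is a dense open
(generic smoothness, `ℝ` perfect, `ℝ[C]` reduced), contains some `𝔭_{c₁}` (density of the
`𝔭_c`), and is stable under the induced automorphisms of `Spec ℝ[C]` over `ℝ`, which move
`𝔭_{c₁}` to any `𝔭_c`. [cite: OnishchikVinberg1990, Ch. 3 §3.3] -/
theorem pointOf_mem_smoothLocus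
    (hhom : ∀ c ∈ C, ∀ c' ∈ C, ∃ (A : 𝔼 ≃L[ℝ] 𝔼) (v : 𝔼), (∀ x ∈ C, A x + v ∈ C) ∧
      (∀ x ∈ C, A.symm x + (-A.symm v) ∈ C) ∧ A c + v = c')
    {c : 𝔼} (hc : c ∈ C) : pointOf hc ∈ (structureMap C).smoothLocus := by
  -- a smooth point among the `𝔭_c`
  have hdense := (structureMap C).dense_smoothLocus_of_perfectField
  haveI : Nontrivial (PolyRing C) := (evalAt hc).toRingHom.domain_nontrivial
  have hne : ((structureMap C).smoothLocus : Set (Spec (CommRingCat.of (PolyRing C)))).Nonempty :=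
    hdense.nonempty
  obtain ⟨c₁, hc₁, h₁⟩ := exists_pointOf_mem_of_isOpen (structureMap C).smoothLocus.2 hne
  -- move it to `𝔭_c`
  obtain ⟨A, v, hAv, hAv', hAc⟩ := hhom c hc c₁ hc₁
  set e : PolyRing C ≃ₐ[ℝ] PolyRing C := pullbackEquiv A v hAv hAv' with he
  set ei : CommRingCat.of (PolyRing C) ≅ CommRingCat.of (PolyRing C) :=
    e.toRingEquiv.toCommRingCatIso with hei
  set σ : Spec (CommRingCat.of (PolyRing C)) ⟶ Spec (CommRingCat.of (PolyRing C)) :=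
    Spec.map ei.hom with hσ
  haveI : IsIso σ := by rw [hσ]; infer_instance
  have hcomp : σ ≫ structureMap C = structureMap C := by
    rw [hσ, structureMap, ← Spec.map_comp]
    congr 1
  have hpre : σ ⁻¹ᵁ (structureMap C).smoothLocus = (structureMap C).smoothLocus := by
    rw [Scheme.Hom.preimage_smoothLocus_eq]
    have key : ∀ (g : Spec (CommRingCat.of (PolyRing C)) ⟶ Spec (CommRingCat.of ℝ))
        (_ : g = structureMap C) [LocallyOfFinitePresentation g],
        g.smoothLocus = (structureMap C).smoothLocus := by
      rintro _ rfl _; rfl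
    exact key _ hcomp
  have hσpt : σ (pointOf hc) = pointOf hc₁ := by
    change PrimeSpectrum.comap (e : PolyRing C →+* PolyRing C) (pointOf hc) = pointOf hc₁
    rw [show pointOf hc₁ = pointOf (hAv c hc) by simp only [hAc]]
    exact comap_pullbackEquiv_pointOf A v hAv hAv' hc
  have : pointOf hc ∈ σ ⁻¹ᵁ (structureMap C).smoothLocus := by
    change σ (pointOf hc) ∈ (structureMap C).smoothLocus
    rw [hσpt]; exact h₁
  rwa [hpre] at this

/-- **The local ring of `Spec ℝ[C]` at a smooth point is a domain** (the smooth locus is an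
open subscheme smooth over `ℝ`, hence regular; regular local rings are domains).
[cite: GortzWedhorn2020, Lemma 6.26] -/
theorem isDomain_stalk_of_mem_smoothLocus {x : Spec (CommRingCat.of (PolyRing C))}
    (hx : x ∈ (structureMap C).smoothLocus) :
    IsDomain ((Spec (CommRingCat.of (PolyRing C))).presheaf.stalk x) := by
  set U : (Spec (CommRingCat.of (PolyRing C))).Opens := (structureMap C).smoothLocus with hU
  -- the open subscheme `U` is smooth over `ℝ`
  haveI : Smooth (U.ι ≫ structureMap C) := by
    rw [← Scheme.Hom.smoothLocus_eq_top_iff, ← Scheme.Hom.preimage_smoothLocus_eq]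
    exact U.ι_preimage_self
  letI : (U : Scheme).Over (Spec (CommRingCat.of ℝ)) := ⟨U.ι ≫ structureMap C⟩
  haveI : Smooth ((U : Scheme) ↘ Spec (CommRingCat.of ℝ)) :=
    inferInstanceAs (Smooth (U.ι ≫ structureMap C))
  have hreg : Scheme.IsRegular (U : Scheme) := Scheme.isRegular_of_smooth_over_field ℝ (U : Scheme)
  -- the stalk of `U` at the point over `x` is the stalk of `Spec ℝ[C]` at `x`
  let y : (U : Scheme) := ⟨x, hx⟩
  haveI := hreg y
  haveI : IsDomain ((U : Scheme).presheaf.stalk y) := isDomain_of_isRegularLocalRing _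
  have hyx : U.ι y = x := rfl
  have e := (asIso (U.ι.stalkMap y)).commRingCatIsoToRingEquiv
  rw [hyx] at e
  exact e.toMulEquiv.isDomain _

/-- **A smooth irreducible basic open neighbourhood.** For `C` real Zariski closed-or-not but
homogeneous as in `pointOf_mem_smoothLocus`, every `c₀ ∈ C` has a basic open `D(t) ∋ 𝔭_{c₀}` of
`Spec ℝ[C]` contained in the smooth locus of `Spec ℝ[C] → Spec ℝ` and irreducible.
[cite: OnishchikVinberg1990, Ch. 3 §3.3] [cite: BochnakCosteRoy1998, Prop. 3.3.11] -/
theorem exists_smooth_irreducible_basicOpen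
    (hhom : ∀ c ∈ C, ∀ c' ∈ C, ∃ (A : 𝔼 ≃L[ℝ] 𝔼) (v : 𝔼), (∀ x ∈ C, A x + v ∈ C) ∧
      (∀ x ∈ C, A.symm x + (-A.symm v) ∈ C) ∧ A c + v = c')
    {c₀ : 𝔼} (hc₀ : c₀ ∈ C) :
    ∃ t : PolyRing C, evalAt hc₀ t ≠ 0 ∧
      ((PrimeSpectrum.basicOpen t : Set (PrimeSpectrum (PolyRing C))) ⊆
        ((structureMap C).smoothLocus : Set (Spec (CommRingCat.of (PolyRing C))))) ∧
      IsIrreducible ((PrimeSpectrum.basicOpen t : Set (PrimeSpectrum (PolyRing C)))) := by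
  set X := Spec (CommRingCat.of (PolyRing C)) with hX
  set x₀ : X := pointOf hc₀ with hx₀
  have hx₀sm : x₀ ∈ (structureMap C).smoothLocus := pointOf_mem_smoothLocus hhom hc₀
  haveI := isDomain_stalk_of_mem_smoothLocus hx₀sm
  -- the unique irreducible component through `x₀` and the complement of the others
  haveI : NoetherianSpace X := inferInstanceAs (NoetherianSpace (PrimeSpectrum (PolyRing C)))
  set Z := irreducibleComponent x₀ with hZ
  have hZmem : Z ∈ irreducibleComponents X := irreducibleComponent_mem_irreducibleComponents x₀
  set Wc : Set X := ⋃₀ (irreducibleComponents X \ {Z}) with hWc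
  have hWc_closed : IsClosed Wc := by
    rw [hWc, Set.sUnion_eq_biUnion]
    exact (NoetherianSpace.finite_irreducibleComponents.subset Set.sdiff_subset).isClosed_biUnion
      fun D hD => isClosed_of_mem_irreducibleComponents D hD.1
  have hx₀Wc : x₀ ∉ Wc := by
    rintro ⟨D, ⟨hD, hDZ⟩, hxD⟩
    exact hDZ (eq_of_mem_irreducibleComponents_of_isDomain_stalk x₀ hD hZmem hxD
      mem_irreducibleComponent)
  -- the open set `O = smooth locus ∖ other components` and a basic open inside it
  set O : Set X := ((structureMap C).smoothLocus : Set X) ∩ Wcᶜ with hO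
  have hOo : IsOpen O := (structureMap C).smoothLocus.2.inter hWc_closed.isOpen_compl
  have hx₀O : x₀ ∈ O := ⟨hx₀sm, hx₀Wc⟩
  have hOZ : O ⊆ Z := by
    intro y hy
    by_contra hyZ
    have hyD : irreducibleComponent y ∈ irreducibleComponents X :=
      irreducibleComponent_mem_irreducibleComponents y
    have hne : irreducibleComponent y ≠ Z := fun h => hyZ (h ▸ mem_irreducibleComponent)
    exact hy.2 ⟨irreducibleComponent y, ⟨hyD, hne⟩, mem_irreducibleComponent⟩
  obtain ⟨_, ⟨t, rfl⟩, hxt, htO⟩ :=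
    PrimeSpectrum.isTopologicalBasis_basic_opens.exists_subset_of_mem_open hx₀O hOo
  refine ⟨t, (pointOf_mem_basicOpen_iff hc₀ t).1 hxt, fun y hy => (htO hy).1, ?_⟩
  -- a non-empty open subset of the irreducible closed set `Z` is irreducible
  have hZirr : IsIrreducible Z := hZmem.1
  refine ⟨⟨x₀, hxt⟩, ?_⟩
  have hsub : (PrimeSpectrum.basicOpen t : Set (PrimeSpectrum (PolyRing C))) ⊆ Z :=
    fun y hy => hOZ (htO hy)
  have := hZirr.2.open_subset (PrimeSpectrum.basicOpen t).2 hsub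
  exact this


/-! ### The model: `W = Spec ℝ[C]_t` and its real points -/

section Model

open Literature.AlgebraicGeometry.Motives
open Literature.AlgebraicGeometry.Motives.AlgPoints (evalOrZero evalOrZero_of_mem ofAlgHom toAlgHom)

/-- `toAlgHom ∘ ofAlgHom = id` on characters (from `Spec.map` faithful). [folklore] -/
theorem toAlgHom_ofAlgHom {R : Type} [CommRing R] [Algebra ℝ R] (e : R →ₐ[ℝ] ℝ) :
    toAlgHom (ofAlgHom e) = e := by
  have h := AlgPoints.ofAlgHom_toAlgHom (ofAlgHom e)
  have h2 : (ofAlgHom (toAlgHom (ofAlgHom e))).toSpecHom = (ofAlgHom e).toSpecHom := by rw [h]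
  rw [AlgPoints.toSpecHom_ofAlgHom, AlgPoints.toSpecHom_ofAlgHom] at h2
  have h3 := Spec.map_injective h2
  have h4 : (toAlgHom (ofAlgHom e)).toRingHom = e.toRingHom :=
    congrArg CommRingCat.Hom.hom h3
  exact AlgHom.ext fun x => RingHom.congr_fun h4 x

set_option maxHeartbeats 800000 in
-- one long packaging proof (instances, characters, points, sections, fractions, embedding)
/-- **A smooth integral real algebraic model of a homogeneous real-Zariski-closed set.** Let
`C ⊆ 𝔼` be real Zariski closed (`hsep`) and homogeneous under affine automorphisms preserving it
(`hhom`), `c₀ ∈ C`. Then there is an affine `ℝ`-scheme `W` (`= Spec ℝ[C]_t` for a suitable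
polynomial function `t` with `t(c₀) ≠ 0`), smooth of some relative dimension `d`, integral,
separated and of finite type, with a real point `Q₀`, and an injective inducing continuous map
`ι : W(ℝ) → 𝔼` with `ι(Q₀) = c₀` and `ι(W(ℝ)) = C ∩ {t ≠ 0}` (an open subset of `C`), such that
every polynomial function on `𝔼` is (through `ι`) a global regular function on `W`, and every
regular function on an open of `W` is, near each real point, the restriction through `ι` of a
real-analytic function on an open subset of `𝔼` (regular functions are locally quotients of
polynomials). [cite: OnishchikVinberg1990, Ch. 3 §3.3] [cite: BochnakCosteRoy1998, Prop. 3.3.11] -/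
theorem exists_smooth_algebraic_model
    (hsep : ∀ z ∉ C, ∃ P : MvPolynomial (𝔼 →L[ℝ] ℝ) ℝ,
      (∀ c ∈ C, MvPolynomial.aeval (R := ℝ) (fun ℓ : 𝔼 →L[ℝ] ℝ => (ℓ : 𝔼 → ℝ)) P c = 0) ∧
        MvPolynomial.aeval (R := ℝ) (fun ℓ : 𝔼 →L[ℝ] ℝ => (ℓ : 𝔼 → ℝ)) P z ≠ 0)
    (hhom : ∀ c ∈ C, ∀ c' ∈ C, ∃ (A : 𝔼 ≃L[ℝ] 𝔼) (v : 𝔼), (∀ x ∈ C, A x + v ∈ C) ∧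
      (∀ x ∈ C, A.symm x + (-A.symm v) ∈ C) ∧ A c + v = c')
    {c₀ : 𝔼} (hc₀ : c₀ ∈ C) :
    ∃ (d : ℕ) (W : SchemeOver ℝ) (_ : SmoothOfRelativeDimension d W.hom) (_ : IsSeparated W.hom)
      (_ : LocallyOfFiniteType W.hom) (_ : QuasiCompact W.hom) (_ : IsIntegral W.left)
      (_ : IsAffine W.left) (Q₀ : AlgPoints W ℝ) (ι : AlgPoints W ℝ → 𝔼),
      ι Q₀ = c₀ ∧ Continuous ι ∧ Topology.IsInducing ι ∧ Function.Injective ι ∧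
      (∀ Q, ι Q ∈ C) ∧
      (∃ O : Set 𝔼, IsOpen O ∧ Set.range ι = C ∩ O) ∧
      (∀ P : MvPolynomial (𝔼 →L[ℝ] ℝ) ℝ, ∃ s : Γ(W.left, ⊤), ∀ Q : AlgPoints W ℝ,
        evalOrZero ⊤ s Q = MvPolynomial.aeval (R := ℝ) (fun ℓ : 𝔼 →L[ℝ] ℝ => (ℓ : 𝔼 → ℝ)) P (ι Q)) ∧
      (∀ (U' : W.left.Opens) (a : Γ(W.left, U')) (Q : AlgPoints W ℝ), Q.pt ∈ U' →
        ∃ (O : Set 𝔼) (Φ : 𝔼 → ℝ), IsOpen O ∧ ι Q ∈ O ∧ AnalyticOnNhd ℝ Φ O ∧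
          ∀ Q' : AlgPoints W ℝ, Q'.pt ∈ U' → ι Q' ∈ O → evalOrZero U' a Q' = Φ (ι Q')) := by
  classical
  -- the good basic open `D(t)`
  obtain ⟨t, ht₀, htsm, htirr⟩ := exists_smooth_irreducible_basicOpen hhom hc₀
  set Rt := Localization.Away t with hRt
  set W : SchemeOver ℝ := specOver ℝ Rt with hW
  -- polynomial representatives of elements of `(PolyRing C)`, and of `t`
  have hrep : ∀ r : (PolyRing C), ∃ P : MvPolynomial (𝔼 →L[ℝ] ℝ) ℝ, ∀ (c : 𝔼) (hc : c ∈ C),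
      evalAt hc r = MvPolynomial.aeval (R := ℝ) (fun ℓ : 𝔼 →L[ℝ] ℝ => (ℓ : 𝔼 → ℝ)) P c := by
    intro r
    obtain ⟨P, rfl⟩ := exists_polyRestrict_eq C r
    exact ⟨P, fun c hc => rfl⟩
  choose rep hrep using hrep
  have hpolycont : ∀ P : MvPolynomial (𝔼 →L[ℝ] ℝ) ℝ,
      Continuous (MvPolynomial.aeval (R := ℝ) (fun ℓ : 𝔼 →L[ℝ] ℝ => (ℓ : 𝔼 → ℝ)) P) := fun P =>
    continuous_iff_continuousAt.2 fun x => (analyticAt_aeval_coeFn P x).continuousAt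
  have hpolyan : ∀ P : MvPolynomial (𝔼 →L[ℝ] ℝ) ℝ,
      AnalyticOnNhd ℝ (MvPolynomial.aeval (R := ℝ) (fun ℓ : 𝔼 →L[ℝ] ℝ => (ℓ : 𝔼 → ℝ)) P) univ :=
    fun P x _ => analyticAt_aeval_coeFn P x
  ------------------------------------------------------------------
  -- instances on `W`
  ------------------------------------------------------------------
  haveI hAff : IsAffine W.left := inferInstanceAs (IsAffine (Spec (CommRingCat.of Rt)))
  haveI : Algebra.FiniteType ℝ Rt := inferInstance
  haveI hft : LocallyOfFiniteType W.hom := by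
    change LocallyOfFiniteType (Spec.map (CommRingCat.ofHom (algebraMap ℝ Rt)))
    rw [HasRingHomProperty.Spec_iff (P := @LocallyOfFiniteType)]
    change (algebraMap ℝ Rt).FiniteType
    rw [RingHom.finiteType_algebraMap]
    infer_instance
  haveI hsepW : IsSeparated W.hom := by
    change IsSeparated (Spec.map (CommRingCat.ofHom (algebraMap ℝ Rt))); infer_instance
  haveI hqcW : QuasiCompact W.hom := by
    change QuasiCompact (Spec.map (CommRingCat.ofHom (algebraMap ℝ Rt))); infer_instance
  -- the open immersion `j : Spec Rt → Spec (PolyRing C)` with image `D(t)`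
  set j : Spec (CommRingCat.of Rt) ⟶ Spec (CommRingCat.of (PolyRing C)) :=
    Spec.map (CommRingCat.ofHom (algebraMap (PolyRing C) Rt)) with hj
  haveI : IsOpenImmersion j := by rw [hj]; exact IsOpenImmersion.of_isLocalization t
  have hjrange : ∀ y : Spec (CommRingCat.of Rt), j y ∈ PrimeSpectrum.basicOpen t := by
    intro y
    have : PrimeSpectrum.comap (algebraMap (PolyRing C) Rt) y ∈
        Set.range (PrimeSpectrum.comap (algebraMap (PolyRing C) Rt)) := ⟨y, rfl⟩
    rw [PrimeSpectrum.localization_away_comap_range Rt t] at this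
    exact this
  haveI hint : IsIntegral W.left := by
    change IsIntegral (Spec (CommRingCat.of Rt))
    haveI : _root_.IsReduced Rt := inferInstanceAs (_root_.IsReduced (Localization (Submonoid.powers t)))
    haveI : IsReduced (Spec (CommRingCat.of Rt)) := (affine_isReduced_iff (CommRingCat.of Rt)).2 ‹_›
    haveI : IrreducibleSpace (Spec (CommRingCat.of Rt)) := by
      have hemb : Topology.IsOpenEmbedding (PrimeSpectrum.comap (algebraMap (PolyRing C) Rt)) :=
        PrimeSpectrum.localization_away_isOpenEmbedding Rt t
      have hpre : IsPreirreducible ((PrimeSpectrum.comap (algebraMap (PolyRing C) Rt)) ⁻¹'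
          (PrimeSpectrum.basicOpen t : Set (PrimeSpectrum (PolyRing C)))) := htirr.2.preimage hemb
      have huniv : (PrimeSpectrum.comap (algebraMap (PolyRing C) Rt)) ⁻¹'
          (PrimeSpectrum.basicOpen t : Set (PrimeSpectrum (PolyRing C))) = univ :=
        Set.eq_univ_of_forall fun y => hjrange y
      rw [huniv] at hpre
      haveI : Nonempty (Spec (CommRingCat.of Rt)) := by
        obtain ⟨x, hx⟩ := htirr.1
        have : x ∈ Set.range (PrimeSpectrum.comap (algebraMap (PolyRing C) Rt)) := by
          rw [PrimeSpectrum.localization_away_comap_range Rt t]; exact hx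
        obtain ⟨y, -⟩ := this
        exact ⟨y⟩
      exact @IrreducibleSpace.mk _ _ ⟨hpre⟩ inferInstance
    exact isIntegral_of_irreducibleSpace_of_isReduced _
  have hsm' : Smooth (j ≫ structureMap C) := by
    rw [← Scheme.Hom.smoothLocus_eq_top_iff, ← Scheme.Hom.preimage_smoothLocus_eq]
    ext y
    simp only [Opens.coe_top, Set.mem_univ, iff_true]
    exact htsm (hjrange y)
  haveI hsmooth : Smooth W.hom := by
    have hfac : W.hom = j ≫ structureMap C := by
      change Spec.map (CommRingCat.ofHom (algebraMap ℝ Rt)) = _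
      rw [hj, structureMap, ← Spec.map_comp, ← CommRingCat.ofHom_comp,
        ← IsScalarTower.algebraMap_eq ℝ (PolyRing C) Rt]
    rw [hfac]
    exact hsm'
  obtain ⟨d, hd⟩ := exists_smoothOfRelativeDimension_of_smooth W.hom
  ------------------------------------------------------------------
  -- characters and points
  ------------------------------------------------------------------
  -- the character of `Rt` at a point `c ∈ C` with `t(c) ≠ 0`
  have hunit : ∀ (c : 𝔼) (hc : c ∈ C), evalAt hc t ≠ 0 →
      ∀ y : Submonoid.powers t, IsUnit ((evalAt hc : (PolyRing C) →ₐ[ℝ] ℝ) y) := by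
    rintro c hc hct ⟨y, n, rfl⟩
    rw [map_pow]
    exact (isUnit_iff_ne_zero.2 hct).pow n
  let chr : ∀ (c : 𝔼) (hc : c ∈ C), evalAt hc t ≠ 0 → (Rt →ₐ[ℝ] ℝ) := fun c hc hct =>
    IsLocalization.liftAlgHom (M := Submonoid.powers t) (hunit c hc hct)
  have hchr : ∀ (c : 𝔼) (hc : c ∈ C) (hct : evalAt hc t ≠ 0) (r : (PolyRing C)),
      chr c hc hct (algebraMap (PolyRing C) Rt r) = evalAt hc r := fun c hc hct r => by
    change IsLocalization.lift (M := Submonoid.powers t) (hunit c hc hct) (algebraMap (PolyRing C) Rt r) = _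
    exact IsLocalization.lift_eq _ r
  -- every character of `Rt` restricts to `evalAt` at a point of `C`
  have hres : ∀ e : Rt →ₐ[ℝ] ℝ, ∃ (c : 𝔼) (hc : c ∈ C),
      e.comp (IsScalarTower.toAlgHom ℝ (PolyRing C) Rt) = evalAt hc := fun e =>
    exists_eq_evalAt hsep _
  choose pt_of hpt_ofC hpt_of using hres
  -- the coordinate map
  let ι : AlgPoints W ℝ → 𝔼 := fun Q => pt_of (toAlgHom Q)
  have hιC : ∀ Q, ι Q ∈ C := fun Q => hpt_ofC _
  have hιev : ∀ (Q : AlgPoints W ℝ) (r : (PolyRing C)),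
      toAlgHom Q (algebraMap (PolyRing C) Rt r) = evalAt (hιC Q) r := fun Q r => by
    have := congrArg (fun φ : (PolyRing C) →ₐ[ℝ] ℝ => φ r) (hpt_of (toAlgHom Q))
    exact this
  have hιt : ∀ Q, evalAt (hιC Q) t ≠ 0 := by
    intro Q h0
    have hu : IsUnit (toAlgHom Q (algebraMap (PolyRing C) Rt t)) :=
      (IsLocalization.Away.algebraMap_isUnit t).map _
    rw [hιev Q t, h0] at hu
    exact not_isUnit_zero hu
  -- characters separate: equal evaluations force equal points
  have hsep_pts : ∀ (c c' : 𝔼) (hc : c ∈ C) (hc' : c' ∈ C),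
      (∀ r : (PolyRing C), evalAt hc r = evalAt hc' r) → c = c' := by
    intro c c' hc hc' h
    refine (Module.finBasis ℝ 𝔼).ext_elem fun i => ?_
    have := h ⟨polyRestrict C (MvPolynomial.X (LinearMap.toContinuousLinearMap
      ((Module.finBasis ℝ 𝔼).coord i))), _, rfl⟩
    rw [evalAt_polyRestrict, evalAt_polyRestrict, MvPolynomial.aeval_X] at this
    exact this
  -- `ι (ofAlgHom (chr c)) = c`
  have hιchr : ∀ (c : 𝔼) (hc : c ∈ C) (hct : evalAt hc t ≠ 0), ι (ofAlgHom (chr c hc hct)) = c := by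
    intro c hc hct
    refine hsep_pts _ _ (hιC _) hc fun r => ?_
    rw [← hιev, toAlgHom_ofAlgHom, hchr c hc hct]
  -- injectivity
  have hιinj : Function.Injective ι := by
    intro Q Q' hQQ'
    have hchar : toAlgHom Q = toAlgHom Q' := by
      have hrh : (toAlgHom Q : Rt →+* ℝ) = (toAlgHom Q' : Rt →+* ℝ) := by
        refine IsLocalization.ringHom_ext (Submonoid.powers t) (RingHom.ext fun r => ?_)
        change toAlgHom Q (algebraMap (PolyRing C) Rt r) = toAlgHom Q' (algebraMap (PolyRing C) Rt r)
        rw [hιev, hιev]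
        have e1 : evalAt (hιC Q) = evalAt (hιC Q') := by
          have : ∀ (c c' : 𝔼) (h : c = c') (hc : c ∈ C) (hc' : c' ∈ C), evalAt hc = evalAt hc' := by
            rintro _ _ rfl _ _; rfl
          exact this _ _ hQQ' _ _
        rw [e1]
      exact AlgHom.ext fun x => RingHom.congr_fun hrh x
    rw [← AlgPoints.ofAlgHom_toAlgHom Q, ← AlgPoints.ofAlgHom_toAlgHom Q', hchar]
  -- values of global sections at points `ofAlgHom e`
  have hevtop : ∀ (e : Rt →ₐ[ℝ] ℝ) (x : Rt),
      (ofAlgHom e).eval ⊤ trivial ((Scheme.ΓSpecIso (CommRingCat.of Rt)).inv x) = e x := by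
    intro e x
    rw [AlgPoints.eval_ofAlgHom_top]
    congr 1
    exact Iso.inv_hom_id_apply _ _
  -- sections from polynomials
  have hsec : ∀ P : MvPolynomial (𝔼 →L[ℝ] ℝ) ℝ, ∃ s : Γ(W.left, ⊤), ∀ Q : AlgPoints W ℝ,
      evalOrZero ⊤ s Q = MvPolynomial.aeval (R := ℝ) (fun ℓ : 𝔼 →L[ℝ] ℝ => (ℓ : 𝔼 → ℝ)) P (ι Q) := by
    intro P
    refine ⟨(Scheme.ΓSpecIso (CommRingCat.of Rt)).inv (algebraMap (PolyRing C) Rt ⟨polyRestrict C P, P, rfl⟩),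
      fun Q => ?_⟩
    obtain ⟨e, rfl⟩ := AlgPoints.ofAlgHom_surjective Q
    rw [evalOrZero_of_mem _ (show (ofAlgHom e).pt ∈ (⊤ : W.left.Opens) from trivial), hevtop,
      ← toAlgHom_ofAlgHom e, hιev, evalAt_polyRestrict, toAlgHom_ofAlgHom]
  -- values of global sections as fractions of polynomials
  have hglob : ∀ f : Γ(W.left, ⊤), ∃ (r : (PolyRing C)) (m : ℕ), ∀ Q : AlgPoints W ℝ,
      Q.eval ⊤ trivial f = MvPolynomial.aeval (R := ℝ) (fun ℓ : 𝔼 →L[ℝ] ℝ => (ℓ : 𝔼 → ℝ)) (rep r) (ι Q) /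
        MvPolynomial.aeval (R := ℝ) (fun ℓ : 𝔼 →L[ℝ] ℝ => (ℓ : 𝔼 → ℝ)) (rep t) (ι Q) ^ m := by
    intro f
    set ft : Rt := (Scheme.ΓSpecIso (CommRingCat.of Rt)).hom f with hft'
    obtain ⟨⟨r, ⟨_, m, rfl⟩⟩, hrm⟩ := IsLocalization.surj (Submonoid.powers t) ft
    refine ⟨r, m, fun Q => ?_⟩
    obtain ⟨e, rfl⟩ := AlgPoints.ofAlgHom_surjective Q
    have hfe : f = (Scheme.ΓSpecIso (CommRingCat.of Rt)).inv ft := by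
      rw [hft']; exact (Iso.hom_inv_id_apply _ _).symm
    have key : e ft * e (algebraMap (PolyRing C) Rt (t ^ m)) = e (algebraMap (PolyRing C) Rt r) := by
      rw [← map_mul]; exact congrArg _ hrm
    rw [← toAlgHom_ofAlgHom e] at key
    rw [hιev, hιev, map_pow, hrep, hrep, toAlgHom_ofAlgHom] at key
    rw [hfe, hevtop, eq_div_iff (pow_ne_zero _ (by rw [← hrep]; exact hιt _)), key]
  ------------------------------------------------------------------
  -- local analytic representation of regular functions
  ------------------------------------------------------------------
  have hloc : ∀ (U' : W.left.Opens) (a : Γ(W.left, U')) (Q : AlgPoints W ℝ), Q.pt ∈ U' →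
      ∃ (O : Set 𝔼) (Φ : 𝔼 → ℝ), IsOpen O ∧ ι Q ∈ O ∧ AnalyticOnNhd ℝ Φ O ∧
        ∀ Q' : AlgPoints W ℝ, Q'.pt ∈ U' → ι Q' ∈ O → evalOrZero U' a Q' = Φ (ι Q') := by
    intro U' a Q hQ
    obtain ⟨f, g, n, hle, hQf, hfrac⟩ :=
      AlgPoints.exists_fraction (L := ℝ) (isAffineOpen_top W.left) a (Opens.mem_top Q.pt) hQ
    obtain ⟨rf, mf, hf⟩ := hglob f
    obtain ⟨rg, mg, hg⟩ := hglob g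
    -- the polynomial data
    set pt' := MvPolynomial.aeval (R := ℝ) (fun ℓ : 𝔼 →L[ℝ] ℝ => (ℓ : 𝔼 → ℝ)) (rep t) with hpt'
    set pf := MvPolynomial.aeval (R := ℝ) (fun ℓ : 𝔼 →L[ℝ] ℝ => (ℓ : 𝔼 → ℝ)) (rep rf) with hpf
    set pg := MvPolynomial.aeval (R := ℝ) (fun ℓ : 𝔼 →L[ℝ] ℝ => (ℓ : 𝔼 → ℝ)) (rep rg) with hpg
    set F : 𝔼 → ℝ := fun z => pf z / pt' z ^ mf with hF
    set G : 𝔼 → ℝ := fun z => pg z / pt' z ^ mg with hG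
    set O : Set 𝔼 := {z | pt' z ≠ 0} ∩ {z | F z ≠ 0} with hO
    have hOt : IsOpen {z : 𝔼 | pt' z ≠ 0} := isOpen_ne_fun (hpolycont _) continuous_const
    have hFan : AnalyticOnNhd ℝ F {z : 𝔼 | pt' z ≠ 0} := fun z hz =>
      (analyticAt_aeval_coeFn _ z).div ((analyticAt_aeval_coeFn _ z).pow _) (pow_ne_zero _ hz)
    have hGan : AnalyticOnNhd ℝ G {z : 𝔼 | pt' z ≠ 0} := fun z hz =>
      (analyticAt_aeval_coeFn _ z).div ((analyticAt_aeval_coeFn _ z).pow _) (pow_ne_zero _ hz)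
    have hOo : IsOpen O := by
      rw [hO]
      exact hFan.continuousOn.isOpen_inter_preimage hOt isOpen_ne
    -- values of `f`, `g` on real points
    have hfval : ∀ Q' : AlgPoints W ℝ, Q'.eval ⊤ trivial f = F (ι Q') := fun Q' => hf Q'
    have hgval : ∀ Q' : AlgPoints W ℝ, Q'.eval ⊤ trivial g = G (ι Q') := fun Q' => hg Q'
    have hιt' : ∀ Q', pt' (ι Q') ≠ 0 := fun Q' => by rw [hpt', ← hrep]; exact hιt Q'
    refine ⟨O, fun z => G z / F z ^ n, hOo, ⟨hιt' Q, ?_⟩, ?_, ?_⟩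
    · show F (ι Q) ≠ 0
      rw [← hfval]
      exact (Q.pt_mem_basicOpen_iff (show Q.pt ∈ (⊤ : W.left.Opens) from trivial) f).1 hQf
    · intro z hz
      exact (hGan z hz.1).div ((hFan z hz.1).pow _) (pow_ne_zero _ hz.2)
    · intro Q' hQ'U hQ'O
      have hQ'f : Q'.pt ∈ W.left.basicOpen f := by
        rw [Q'.pt_mem_basicOpen_iff (show Q'.pt ∈ (⊤ : W.left.Opens) from trivial) f, hfval]
        exact hQ'O.2
      have key := hfrac Q' hQ'f
      rw [evalOrZero_of_mem _ hQ'U]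
      have hF0 : F (ι Q') ≠ 0 := hQ'O.2
      have e1 : Q'.eval ⊤ (W.left.basicOpen_le f hQ'f) f = F (ι Q') := hfval Q'
      have e2 : Q'.eval ⊤ (W.left.basicOpen_le f hQ'f) g = G (ι Q') := hgval Q'
      rw [e1, e2] at key
      have e3 : Q'.eval U' (hle hQ'f) a = Q'.eval U' hQ'U a := rfl
      rw [← e3, eq_div_iff (pow_ne_zero _ hF0)]
      exact key
  ------------------------------------------------------------------
  -- continuity and the embedding property
  ------------------------------------------------------------------
  have hιcont : Continuous ι := by
    -- `ι Q = Σᵢ sᵢ(Q) bᵢ` with `sᵢ` the section of the `i`-th coordinate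
    set b := Module.finBasis ℝ 𝔼 with hb
    have hsi := fun i => hsec (MvPolynomial.X (LinearMap.toContinuousLinearMap (b.coord i)))
    choose sc hsc using hsi
    have hιeq : ι = fun Q => ∑ i, evalOrZero ⊤ (sc i) Q • b i := by
      funext Q
      conv_lhs => rw [← b.sum_repr (ι Q)]
      refine Finset.sum_congr rfl fun i _ => ?_
      rw [hsc i Q, MvPolynomial.aeval_X]
      rfl
    rw [hιeq]
    refine continuous_finsetSum _ fun i _ => Continuous.smul ?_ continuous_const
    have := AlgPoints.continuousOn_evalOrZero (X := W) (L := ℝ) ⊤ (sc i)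
    rw [show {P : AlgPoints W ℝ | P.pt ∈ (⊤ : W.left.Opens)} = univ from
      Set.eq_univ_of_forall fun P => trivial] at this
    exact continuousOn_univ.1 this
  have hιind : Topology.IsInducing ι := by
    rw [Topology.isInducing_iff_nhds]
    intro Q
    apply le_antisymm
    · exact (hιcont.tendsto Q).le_comap
    · rw [AlgPoints.nhds_eq_of_mem_affineOpen (isAffineOpen_top W.left)
        (show Q.pt ∈ (⊤ : W.left.Opens) from trivial)]
      refine le_inf ?_ (le_iInf fun a => ?_)
      · exact Filter.le_principal_iff.2 (Filter.univ_mem' fun Q' => trivial)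
      · obtain ⟨O, Φ, hOo, hQO, hΦ, hval⟩ := hloc ⊤ a Q trivial
        intro S hS
        rw [Filter.mem_comap] at hS ⊢
        obtain ⟨V, hV, hVS⟩ := hS
        have hΦQ : Φ (ι Q) = evalOrZero ⊤ a Q := (hval Q trivial hQO).symm
        refine ⟨O ∩ Φ ⁻¹' V, ?_, ?_⟩
        · refine (hOo.mem_nhds hQO) |> fun hOn => Filter.inter_mem hOn ?_
          exact (hΦ _ hQO).continuousAt.preimage_mem_nhds (by rw [hΦQ]; exact hV)
        · intro Q' hQ'
          apply hVS
          show evalOrZero ⊤ a Q' ∈ V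
          rw [hval Q' trivial hQ'.1]
          exact hQ'.2
  ------------------------------------------------------------------
  -- the base point and the range
  ------------------------------------------------------------------
  set Q₀ : AlgPoints W ℝ := ofAlgHom (chr c₀ hc₀ ht₀) with hQ₀
  have hιQ₀ : ι Q₀ = c₀ := hιchr c₀ hc₀ ht₀
  have hrange : Set.range ι = C ∩ {z | MvPolynomial.aeval (R := ℝ)
      (fun ℓ : 𝔼 →L[ℝ] ℝ => (ℓ : 𝔼 → ℝ)) (rep t) z ≠ 0} := by
    ext z
    constructor
    · rintro ⟨Q, rfl⟩
      exact ⟨hιC Q, by rw [Set.mem_setOf_eq, ← hrep]; exact hιt Q⟩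
    · rintro ⟨hzC, hzt⟩
      rw [Set.mem_setOf_eq, ← hrep _ z hzC] at hzt
      exact ⟨ofAlgHom (chr z hzC hzt), hιchr z hzC hzt⟩
  exact ⟨d, W, hd, hsepW, hft, hqcW, hint, hAff, Q₀, ι, hιQ₀, hιcont, hιind, hιinj, hιC,
    ⟨_, isOpen_ne_fun (hpolycont _) continuous_const, hrange⟩, hsec, hloc⟩

end Model

end Literature.AlgebraicGeometry.RealAlgebraic

end
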